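import Summits.QuantumFields.YangMills.Theses.FradkinShenkerFlow

/-!
# Line `planted-link-pinning` for crux `FradkinShenkerFlow.SusceptibilityToPoincare` (stmt-QuantumFields-9441)

Skeleton (crux-plan, planner-cruxplan-stmt-QuantumFields-9441-planted-link-pinning-0, 2026-08-15;
idea card `Cruxes/SusceptibilityToPoincare/Ideas/planted-link-pinning.md`, ideator k=1, round 1;
triage `TRIAGE-r1-1.md`: **pass**, with sharpenings (α) scope π₁(G) = 0, (β) FS is consumed
quantitatively, (γ) file card `orbit-slice-reduction` as the common first stub).

The crux (FIXED, concluded BY NAME below): for every compact simple `G`, faithful unitary `r`, `β ≥ 0`,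
`FS(G,r,β) → UP(G,r,β)` — finite gauge-invariant susceptibility of the torus Wilson measures
`μ_{β,S}` (uniformly in the side `2S+1`) implies a volume-uniform single-link HEAT-BATH Poincaré
inequality `Var_μ F ≤ C Σ_ℓ ∫∫ (F U − F(U[ℓ↦g]))² dν_ℓ^U dμ` for all bounded measurable `F`
(`crux_iff` below is the `Iff.rfl` bridge to the named clauses `FiniteSusceptibility`, `UniformPoincare`).

THE LINE (Nishimori / planted LINK-PINNING localisation = coordinate-by-coordinate Doob localisation of
Chen–Eldan arXiv:2203.04163 §2.1.1 run on links with PLANTED values, i.e. conditioning `μ` on the values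
of a Bernoulli(1−ε) random set `Λ` of links drawn from `μ` itself; the associated dynamics is the
ε|E|-block heat bath).  Writing `PCV_ε(F) := E_Λ E_μ Var_μ(F | U_Λ)` (`plantedCondVar`, free density `ε`)
and `ℰ_hb(F) := Σ_ℓ ∫∫ (F U − F(U[ℓ↦g]))² dν_ℓ^U dμ` (`hbDirichlet`, = 2 Σ_ℓ E_μ Var_{ν_ℓ} F):

* `stub_orbitSlice` (S1, provable now, size L) — ORBIT-SLICE REDUCTION (card `orbit-slice-reduction`,
  triage: "true theorem, file as stub 0"): `UP_inv(C) ⇒ UP(C + 2e^{O(β)})`, i.e. it suffices to prove the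
  heat-bath Poincaré inequality for gauge-INVARIANT bounded measurable `F`.  `Var_μ F = Var_μ F̄ +
  E_μ Var_{G^V}(g ↦ F(U^g))`, Efron–Stein on the gauge group `G^{sites}`, one-site Holley–Stroock
  (`e^{±O(β)}` density of the 8 links at a site w.r.t. Haar⁸), kernel–gauge commutation `ℰ_hb(F̄) ≤ ℰ_hb(F)`.
* `stub_elitzurBessel` (S2, provable now, size M) — DENSITY-ZERO ANCHOR: the unpinned Wilson measure is
  spectrally independent with the product-measure constant, `Σ_ℓ Var_μ(E_μ[φ | U_ℓ]) ≤ Var_μ φ` for every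
  bounded measurable `φ`, every compact `G`, every `β`, side ≥ 3: distinct links are pairwise INDEPENDENT
  under a gauge-invariant law (rotate the gauge at an endpoint of `ℓ` not on `ℓ'`; `2e_μ ≢ 0 mod 2S+1`),
  so the centred subspaces `L²₀(σ(U_ℓ))` are pairwise orthogonal and Bessel applies (the L²-strengthening
  of the route's `ElitzurLinkCovariance`).  Consumed by S4 as its base case `η(ν₀) = η(μ) ≤ 1`.
* `stub_plantedTerminal` (S3, provable now, size L) — TERMINAL STAGE IS EXACT INDEPENDENCE: there is
  `ε₀(G,r,β) ∈ (0,1)` such that for `0 < ε ≤ ε₀`, `PCV_ε(F) ≤ C(β,ε) ℰ_hb(F)` uniformly in `S` for all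
  bounded measurable `F`: given the pins, free links interact only through shared plaquettes, so `μ(·|U_Λ)`
  is a PRODUCT over the plaquette-connected free clusters `K` (subcritical site percolation on the
  18-regular link graph: `P(|K(ℓ)| = k) ≤ (18eε)^{k−1}`); Efron–Stein across clusters, Holley–Stroock vs
  `Haar^K` inside a cluster (`C_K ≤ e^{cβ|K|}`, ≤ 6|K| plaquettes) and Efron–Stein for `Haar^K`; `Λ ⊥ U`
  and the tower property (Nishimori consistency `E_U E_{μ(·|U_Λ)} = E_μ`) pull the one-link conditional
  variances back to `μ`: `C(β,ε) = Σ_k (18eε)^{k−1} e^{c'βk} < ∞`.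
* `stub_plantedLocalToGlobal` (S4, OPEN — the crux's content, HARDEST, load-bearing) — PLANTED
  LOCAL-TO-GLOBAL for simply-connected simple `G`: given `EB` (S2's conclusion) and `FS(G,r,β)`, for every
  `ε₀ > 0` there are a free density `0 < ε ≤ ε₀` and `C ≥ 0` with `Var_μ F ≤ C · PCV_ε(F)` for all `S` and
  all gauge-INVARIANT bounded measurable `F` (no planted pin-density transition).  Chen–Eldan's one-step
  law of total variance `E[Var_{ν_i}φ | ν_{i−1}] = (1 − η_φ(ν_{i−1})/#free) Var_{ν_{i−1}}φ` holds pathwise on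
  any state space; the work is to bound the φ-dependent path factor in planted MEAN using (b) pins on
  forests are pure gauge (invariant sector sees only pinned-CYCLE holonomies, density `O(θ⁴)`), (c) a free
  link explains variance of an invariant `φ` only when FRAMED, and then through the response of `φ` to a
  LOCAL gauge-invariant composite — an FS susceptibility (`E_pins Cov(x_ℓ,x_ℓ'|pins) = −Cov_μ(E[x_ℓ|pins],
  E[x_ℓ'|pins])`), with an FS-free tail over large pinned-cluster shapes (triage (β)), and the ellipticity
  floor `η(ν) ≤ e^{cβ·(local free-cluster size)}`; the sup-over-pinnings version (ALO/Chen–Eldan Thm 24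
  verbatim) is FALSE here (adversarial pins = gauge glass), hence "share-localised" spectral independence.
* `stub_centrelessResidual` (S5, NOT CLAIMED BY THE LINE — residual scope of the crux as typed):
  `IsCompactSimpleLieGroup` admits centreless `G` (`SO(3)`, `PSU(N)`: `π₁(G) ≠ 0`), where the ideator's
  OBSTRUCTION note (evidence `OBSTRUCTION-centreless-groups.md`) and the triager expect `UP` to FAIL with
  `FS` intact ('t Hooft magnetic-twist sectors: gauge-invariant slow modes, barrier `≍ βS`).  The line's
  mechanism is void there (a framed free link can close a pinned 2-torus and carries the twist label), so
  the residual implication `FS → UP_inv` for `¬ SimplyConnectedSpace G` is isolated as its own registered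
  stub: `¬ S5 ↔ ¬ crux on centreless G` (a cdisprove target, not a prover target); if the tenure planner
  re-scopes the crux to simply-connected `G` (triage sharpening (α); `SU(N)` and the summit unaffected),
  S5 is vacuous and S1–S4 are untouched.
* `SusceptibilityToPoincare_of` — the kernel-checked, sorry-free composition: `UP ⟸ UP_inv` (S1); for
  `π₁(G) = 0`: `ε₀` from S3, `(ε, C_M)` from S4 fed with S2 and FS, `C_T` from S3 at `ε`, so
  `Var F ≤ C_M PCV_ε F ≤ C_M C_T ℰ_hb F` for invariant `F`; for `π₁(G) ≠ 0`: S5.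

Disproof.lean: none exists for this crux yet (payload `disproof_path` absent on disk, `ledger crux ls`
lists no `Disproof.lean`, 2026-08-15T23:50Z) — no `_false_without_` theorem to honour, no landed
`Theorems/SusceptibilityToPoincare/Negative/` lemma to import.  Honoured instead: the refuters' recorded
calibrations on the item — FS is ℓ¹-summability not finite ξ (g41-7: no rate is used anywhere, only
covariance sums), the decoration test (rreview: FS is load-bearing, in S4 only), TV-Dobrushin would need
`s ≳ β²` (rreview on 9446: this line has NO pinning strength — the terminal regime is exact independence),
and the OBSTRUCTION note (S5 isolates exactly its regime).  Negatives index (`ledger negatives`, 4 entries: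
QCD ×3, MirrorModularBoosts): none concerns this statement or any stub.

All stub statements are written over `Literature` + Mathlib vocabulary ONLY (fully qualified), so a stub
worker imports the route file and nothing from this directory; the `*_iff` lemmas are the `Iff.rfl`
bridges to the readable predicates of §Vocabulary.
-/

set_option linter.unusedVariables false

namespace Summit.QuantumFields.YangMills.Cruxes.SusceptibilityToPoincare.PlantedLinkPinning

open MeasureTheory ProbabilityTheory
open Literature.MathematicalPhysics.QuantumFieldTheory Literature.MathematicalPhysics.QuantumLattice
open Summit.QuantumFields.YangMills.Theses.FradkinShenkerFlow

/-! ## Vocabulary (readable predicates; the stubs below are their verbatim expansions) -/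

section Vocabulary

variable (G : Type) [Group G] [TopologicalSpace G] [IsTopologicalGroup G] [CompactSpace G]
  [MeasurableSpace G] [BorelSpace G]

/-- The single-link HEAT-BATH Dirichlet form of the crux,
`ℰ_hb(F) = Σ_ℓ ∫∫ (F U − F(U[ℓ ↦ g]))² dν_ℓ^U(g) dμ_{β,S}(U)`, `ν_ℓ^U = Haar.tilted(−β S_W(U[ℓ↦·]))` the
one-link conditional law (`= 2 Σ_ℓ E_μ Var_{ν_ℓ^U} F`). [folklore] -/
noncomputable def hbDirichlet (r : LatticeRep G) (β : ℝ) (S : ℕ)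
    (F : GaugeConfig 4 (2 * S + 1) G → ℝ) : ℝ :=
  ∑ ℓ : Edge 4 (2 * S + 1), ∫ U, ∫ g, (F U - F (Function.update U ℓ g)) ^ 2
    ∂((haarProbability G).tilted (fun g' => -β * wilsonAction r.ρ (Function.update U ℓ g')))
    ∂(wilsonMeasure (d := 4) (L := 2 * S + 1) r.ρ β)

/-- `UP(G,r,β)`: the conclusion of the crux — a heat-bath Poincaré inequality uniform in the side. -/
def UniformPoincare (r : LatticeRep G) (β : ℝ) : Prop :=
  ∃ C : ℝ, ∀ S : ℕ, ∀ F : GaugeConfig 4 (2 * S + 1) G → ℝ, Measurable F →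
    (∃ M : ℝ, ∀ U, |F U| ≤ M) →
      ProbabilityTheory.variance F (wilsonMeasure (d := 4) (L := 2 * S + 1) r.ρ β) ≤
        C * hbDirichlet G r β S F

/-- `UP_inv(G,r,β)`: the same inequality for gauge-INVARIANT bounded measurable `F` only. -/
def UniformPoincareInv (r : LatticeRep G) (β : ℝ) : Prop :=
  ∃ C : ℝ, ∀ S : ℕ, ∀ F : GaugeConfig 4 (2 * S + 1) G → ℝ, Measurable F →
    (∃ M : ℝ, ∀ U, |F U| ≤ M) → IsGaugeInvariant F →
      ProbabilityTheory.variance F (wilsonMeasure (d := 4) (L := 2 * S + 1) r.ρ β) ≤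
        C * hbDirichlet G r β S F

/-- `FS(G,r,β)`: the hypothesis of the crux — finite gauge-invariant susceptibility, uniformly in `S`. -/
def FiniteSusceptibility (r : LatticeRep G) (β : ℝ) : Prop :=
  ∀ A B : YMSpecies G, ∃ χ : ℝ, ∀ S : ℕ,
    ∑ x ∈ Literature.Probability.LatticeModels.box 4 S,
      |ProbabilityTheory.covariance (fun U => A.F (torusLift (2 * S + 1) U))
        (fun U => B.F (configShift (-x) (torusLift (2 * S + 1) U)))
        (wilsonMeasure (d := 4) (L := 2 * S + 1) r.ρ β)| ≤ χ

/-- `σ(U_ℓ)`: the σ-algebra generated by one link variable. -/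
abbrev linkSigma (S : ℕ) (ℓ : Edge 4 (2 * S + 1)) : MeasurableSpace (GaugeConfig 4 (2 * S + 1) G) :=
  MeasurableSpace.comap (fun V : GaugeConfig 4 (2 * S + 1) G => V ℓ) inferInstance

/-- `σ(U_Λ)`: the σ-algebra generated by the PINNED links `Λ`. -/
abbrev pinSigma (S : ℕ) (Λ : Finset (Edge 4 (2 * S + 1))) :
    MeasurableSpace (GaugeConfig 4 (2 * S + 1) G) :=
  ⨆ ℓ ∈ Λ, MeasurableSpace.comap (fun V : GaugeConfig 4 (2 * S + 1) G => V ℓ) inferInstance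

/-- `EB(G,r,β)`: spectral independence of the unpinned Wilson measure with constant 1 (Elitzur–Bessel):
`Σ_ℓ Var_μ(E_μ[φ | σ(U_ℓ)]) ≤ Var_μ φ` on every torus of side `2S+1 ≥ 3`. -/
def ElitzurBessel (r : LatticeRep G) (β : ℝ) : Prop :=
  ∀ S : ℕ, 1 ≤ S → ∀ φ : GaugeConfig 4 (2 * S + 1) G → ℝ, Measurable φ →
    (∃ M : ℝ, ∀ U, |φ U| ≤ M) →
      ∑ ℓ : Edge 4 (2 * S + 1), ProbabilityTheory.variance
          ((wilsonMeasure (d := 4) (L := 2 * S + 1) r.ρ β)[φ | linkSigma G S ℓ])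
          (wilsonMeasure (d := 4) (L := 2 * S + 1) r.ρ β) ≤
        ProbabilityTheory.variance φ (wilsonMeasure (d := 4) (L := 2 * S + 1) r.ρ β)

/-- `PCV_ε(F)`: the PLANTED conditional variance at free density `ε` — pin every link independently with
probability `1 − ε` at its value in `U ∼ μ_{β,S}` and average the conditional variance:
`Σ_Λ ε^{|E∖Λ|} (1−ε)^{|Λ|} ∫ Var_μ[F | σ(U_Λ)] dμ` (`= E_Λ E_μ Var(F | U_Λ)`; `PCV_1 = Var`, `PCV_0 = 0`). -/
noncomputable def plantedCondVar (r : LatticeRep G) (β : ℝ) (S : ℕ) (ε : ℝ)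
    (F : GaugeConfig 4 (2 * S + 1) G → ℝ) : ℝ :=
  ∑ Λ : Finset (Edge 4 (2 * S + 1)),
    ε ^ (Fintype.card (Edge 4 (2 * S + 1)) - Λ.card) * (1 - ε) ^ Λ.card *
      ∫ U, ProbabilityTheory.condVar (pinSigma G S Λ) F
          (wilsonMeasure (d := 4) (L := 2 * S + 1) r.ρ β) U
        ∂(wilsonMeasure (d := 4) (L := 2 * S + 1) r.ρ β)

/-- `PlantedLocalToGlobalAt G r β ε C`: the planted local-to-global inequality at free density `ε` with
constant `C` for gauge-invariant bounded measurable `F`, uniformly in `S`. -/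
def PlantedLocalToGlobalAt (r : LatticeRep G) (β ε C : ℝ) : Prop :=
  ∀ (S : ℕ) (F : GaugeConfig 4 (2 * S + 1) G → ℝ), Measurable F → (∃ M : ℝ, ∀ U, |F U| ≤ M) →
    IsGaugeInvariant F →
      ProbabilityTheory.variance F (wilsonMeasure (d := 4) (L := 2 * S + 1) r.ρ β) ≤
        C * plantedCondVar G r β S ε F

/-- `PlantedTerminalAt G r β ε C`: the terminal comparison at free density `ε` with constant `C`,
`PCV_ε(F) ≤ C ℰ_hb(F)` for all bounded measurable `F`, uniformly in `S`. -/
def PlantedTerminalAt (r : LatticeRep G) (β ε C : ℝ) : Prop :=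
  ∀ (S : ℕ) (F : GaugeConfig 4 (2 * S + 1) G → ℝ), Measurable F → (∃ M : ℝ, ∀ U, |F U| ≤ M) →
    plantedCondVar G r β S ε F ≤ C * hbDirichlet G r β S F

end Vocabulary

/-- Definitional bridge: the crux is `∀ G simple, ∀ r, ∀ β ≥ 0, FS → UP` in the vocabulary above. -/
theorem crux_iff :
    SusceptibilityToPoincare ↔
      ∀ (G : Type) [Group G] [TopologicalSpace G] [IsTopologicalGroup G] [CompactSpace G]
        [MeasurableSpace G] [BorelSpace G], IsCompactSimpleLieGroup G →
        ∀ (r : LatticeRep G) (β : ℝ), 0 ≤ β → FiniteSusceptibility G r β → UniformPoincare G r β :=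
  Iff.rfl

/-! ## The five registered stubs (`sorry` only here; statements over Literature + Mathlib, fully qualified) -/

/-- **S1 · orbit-slice reduction `UP_inv ⇒ UP`** (`stub_orbitSlice`; card `orbit-slice-reduction`,
triage r1-1: TRUE, "file as the common first stub").  For every compact `G`, lattice representation `r`
and `β ≥ 0`: a volume-uniform heat-bath Poincaré inequality for gauge-INVARIANT bounded measurable `F`
implies one for ALL bounded measurable `F` (constant `C_inv + 2e^{Cβ}`, `C ≈ 10² N`).  Proof on paper
(triage (i), verified line by line): `Var_μ F = Var_μ F̄ + E_μ Var_{G^V}(g ↦ F(U^g))` with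
`F̄(U) = ∫ F(U^g) dg` (bounded, measurable, invariant; cross term vanishes by invariance of `μ`,
`wilsonMeasure_map_gaugeTransform_holds`); Efron–Stein on `Haar^{V}` and `U^g = (U^{g_{−x}})^{g_x}` reduce
to `Σ_x E_μ Var_{g_x} F(U^{g_x})`; at one site, conditionally on the links off `x`,
`E_u Var_g F(g·u) ≤ Var_{Haar⁸} F ≤ Σ_{ℓ∋x} E Var_{Haar,ℓ} F` and the conditional law of the 8 links at
`x` has density `e^{±O(β)}` w.r.t. `Haar⁸` (24 plaquettes), so `E_μ Var_{G^V} ≤ 2e^{Cβ} ℰ_hb(F)`;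
finally `ℰ_hb(F̄) ≤ ℰ_hb(F)` because `P_orb = ∫γ_g dg` and `I − K_ℓ` are commuting orthogonal projections
in `L²(μ)` (kernel–gauge commutation `ν_ℓ^{U^g} = (h ↦ g_x h g_y⁻¹)_* ν_ℓ^U`).  No simplicity, no
faithfulness.  Size L (Fubini/condExp plumbing; Efron–Stein and Holley–Stroock are not in Mathlib).
Leans on: `gaugeTransform`, `IsGaugeInvariant`, `wilsonAction_gaugeTransform`,
`wilsonMeasure_map_gaugeTransform_holds`, `isProbabilityMeasure_wilsonMeasure`, `haarProbability`,
Mathlib `Measure.pi`, `Measure.tilted`, `ProbabilityTheory.variance`, `MeasureTheory.condExp`.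
`stub_orbitSlice_iff`: this is `∀ G r β, 0 ≤ β → UniformPoincareInv G r β → UniformPoincare G r β`. -/
theorem stub_orbitSlice :
    ∀ (G : Type) [Group G] [TopologicalSpace G] [IsTopologicalGroup G] [CompactSpace G]
      [MeasurableSpace G] [BorelSpace G],
      ∀ (r : Literature.MathematicalPhysics.QuantumFieldTheory.LatticeRep G) (β : ℝ), 0 ≤ β →
        (∃ C : ℝ, ∀ S : ℕ,
          ∀ F : Literature.MathematicalPhysics.QuantumFieldTheory.GaugeConfig 4 (2 * S + 1) G → ℝ,
            Measurable F → (∃ M : ℝ, ∀ U, |F U| ≤ M) →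
            Literature.MathematicalPhysics.QuantumFieldTheory.IsGaugeInvariant F →
              ProbabilityTheory.variance F
                  (Literature.MathematicalPhysics.QuantumFieldTheory.wilsonMeasure (d := 4)
                    (L := 2 * S + 1) r.ρ β) ≤
                C * ∑ ℓ : Literature.MathematicalPhysics.QuantumFieldTheory.Edge 4 (2 * S + 1),
                  ∫ U, ∫ g, (F U - F (Function.update U ℓ g)) ^ 2
                    ∂((Literature.MathematicalPhysics.QuantumFieldTheory.haarProbability G).tilted
                      (fun g' => -β * Literature.MathematicalPhysics.QuantumFieldTheory.wilsonAction
                        r.ρ (Function.update U ℓ g')))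
                    ∂(Literature.MathematicalPhysics.QuantumFieldTheory.wilsonMeasure (d := 4)
                      (L := 2 * S + 1) r.ρ β)) →
        (∃ C : ℝ, ∀ S : ℕ,
          ∀ F : Literature.MathematicalPhysics.QuantumFieldTheory.GaugeConfig 4 (2 * S + 1) G → ℝ,
            Measurable F → (∃ M : ℝ, ∀ U, |F U| ≤ M) →
              ProbabilityTheory.variance F
                  (Literature.MathematicalPhysics.QuantumFieldTheory.wilsonMeasure (d := 4)
                    (L := 2 * S + 1) r.ρ β) ≤
                C * ∑ ℓ : Literature.MathematicalPhysics.QuantumFieldTheory.Edge 4 (2 * S + 1),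
                  ∫ U, ∫ g, (F U - F (Function.update U ℓ g)) ^ 2
                    ∂((Literature.MathematicalPhysics.QuantumFieldTheory.haarProbability G).tilted
                      (fun g' => -β * Literature.MathematicalPhysics.QuantumFieldTheory.wilsonAction
                        r.ρ (Function.update U ℓ g')))
                    ∂(Literature.MathematicalPhysics.QuantumFieldTheory.wilsonMeasure (d := 4)
                      (L := 2 * S + 1) r.ρ β)) := by
  sorry

/-- **S2 · Elitzur–Bessel: the unpinned Wilson measure is spectrally independent with constant 1**
(`stub_elitzurBessel`; the card's First lemma, triage r1-1 (i): TRUE for every compact `G`, every `β`,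
every side `2S+1 ≥ 3`).  For bounded measurable `φ`, `Σ_ℓ Var_μ(E_μ[φ | σ(U_ℓ)]) ≤ Var_μ φ`: two distinct
links of the side-`(2S+1)` torus (`S ≥ 1`) always leave one of them an endpoint not on the other (else
`2e_μ ≡ 0 mod 2S+1`); rotating the gauge there (`wilsonMeasure_map_gaugeTransform_holds`, right-invariance
of Haar) shows the joint law of `(U_ℓ, U_ℓ')` is invariant under `u_ℓ ↦ g u_ℓ`, hence `U_ℓ ∼ Haar` and
`U_ℓ ⊥ U_ℓ'` — distinct links are PAIRWISE INDEPENDENT; so the centred subspaces `L²₀(σ(U_ℓ))` are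
pairwise orthogonal, `E[φ|U_ℓ] − Eφ` is the orthogonal projection of `φ − Eφ` onto them, and Bessel's
inequality gives the claim (equality on `φ = f(U_ℓ)`: `η(μ_{β,S}) = 1`).  `S = 0` (side 1, self-loops,
conjugation action) is correctly excluded.  Size M.  Leans on: `wilsonMeasure_map_gaugeTransform_holds`,
`isProbabilityMeasure_wilsonMeasure`, Mathlib `condExp` as the `L²` orthogonal projection
(`MeasureTheory.condExpL2`), `ProbabilityTheory.variance`, `ProbabilityTheory.IndepFun`.
`stub_elitzurBessel_iff`: this is `∀ G r β, ElitzurBessel G r β`. -/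
theorem stub_elitzurBessel :
    ∀ (G : Type) [Group G] [TopologicalSpace G] [IsTopologicalGroup G] [CompactSpace G]
      [MeasurableSpace G] [BorelSpace G],
      ∀ (r : Literature.MathematicalPhysics.QuantumFieldTheory.LatticeRep G) (β : ℝ) (S : ℕ), 1 ≤ S →
        ∀ φ : Literature.MathematicalPhysics.QuantumFieldTheory.GaugeConfig 4 (2 * S + 1) G → ℝ,
          Measurable φ → (∃ M : ℝ, ∀ U, |φ U| ≤ M) →
            ∑ ℓ : Literature.MathematicalPhysics.QuantumFieldTheory.Edge 4 (2 * S + 1),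
              ProbabilityTheory.variance
                ((Literature.MathematicalPhysics.QuantumFieldTheory.wilsonMeasure (d := 4)
                    (L := 2 * S + 1) r.ρ β)[φ |
                  MeasurableSpace.comap
                    (fun V : Literature.MathematicalPhysics.QuantumFieldTheory.GaugeConfig 4
                      (2 * S + 1) G => V ℓ) inferInstance])
                (Literature.MathematicalPhysics.QuantumFieldTheory.wilsonMeasure (d := 4)
                  (L := 2 * S + 1) r.ρ β) ≤
              ProbabilityTheory.variance φ
                (Literature.MathematicalPhysics.QuantumFieldTheory.wilsonMeasure (d := 4)
                  (L := 2 * S + 1) r.ρ β) := by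
  sorry

/-- **S3 · planted terminal stage: exact independence at small free density** (`stub_plantedTerminal`;
the card's Second lemma `planted_terminal_stage`, triage r1-1 (i)(d): TRUE with `C = C(β,ε)` uniform in
`S`).  For every compact `G`, `r`, `β ≥ 0` there is `ε₀ ∈ (0,1)` (order `e^{−cβ}/(18e)`) such that for
every free density `0 < ε ≤ ε₀` some `C ≥ 0` gives, for all `S` and all bounded measurable `F`,
`PCV_ε(F) = Σ_Λ ε^{|E∖Λ|}(1−ε)^{|Λ|} ∫ Var_μ[F | σ(U_Λ)] dμ ≤ C · ℰ_hb(F)`.  Why: conditionally on the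
pinned links `U_Λ`, the free links interact only through plaquettes containing ≥ 2 free links, so
`μ(· | U_Λ)` is a PRODUCT over the plaquette-connected free clusters `K` (a free link all of whose 18
staple-sharing links are pinned has a deterministic one-link law `ν_ℓ^U`); Efron–Stein across the
independent clusters, Holley–Stroock inside a cluster (density `e^{±2βN·6|K|}` w.r.t. `Haar^K`) and
Efron–Stein for `Haar^K` give `Var(F | U_Λ) ≤ Σ_K e^{c'β|K|} Σ_{ℓ∈K} E[Var_{ν_ℓ^U} F | U_Λ]`; the cluster
of `ℓ` depends on `Λ` only, `Λ ⊥ U`, and the tower property returns `E_μ Var_{ν_ℓ^U} F = ½`(the `ℓ`-th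
summand of `ℰ_hb`); the size of the free cluster of a given link in Bernoulli(ε) site percolation on the
18-regular link graph has tail `≤ (18eε)^{k−1}`, so `C = ½ Σ_k (18eε)^{k−1} e^{c'βk} < ∞` for
`18e^{1+c'β} ε < 1`.  Each fixed `S` alone is a finite-dimensional Holley–Stroock comparison, so only
uniformity matters; `ℰ_hb(F) = 0 ⇒ F` a.e. constant (full support of the heat-bath laws) `⇒ PCV = 0`.
Size L (product structure of a conditioned Gibbs measure + a percolation cluster-size bound; neither is
in Mathlib).  Leans on: `wilsonMeasure`, `wilsonAction`, `plaquetteHolonomy`, `haarProbability`,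
`siteLaw_ymSpecification_eq_tilted_haar` (one-link law = tilted Haar, `LatticeGaugeDobrushin`), Mathlib
`ProbabilityTheory.condVar`, `condExp`, `Measure.pi`, `Measure.tilted`, `Finset.sum_pow_mul_eq_add_pow`.
`stub_plantedTerminal_iff`: this is `∀ G r β, 0 ≤ β → ∃ ε₀ ∈ (0,1), ∀ ε ∈ (0,ε₀], ∃ C ≥ 0,
PlantedTerminalAt G r β ε C`. -/
theorem stub_plantedTerminal :
    ∀ (G : Type) [Group G] [TopologicalSpace G] [IsTopologicalGroup G] [CompactSpace G]
      [MeasurableSpace G] [BorelSpace G],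
      ∀ (r : Literature.MathematicalPhysics.QuantumFieldTheory.LatticeRep G) (β : ℝ), 0 ≤ β →
        ∃ ε₀ : ℝ, 0 < ε₀ ∧ ε₀ < 1 ∧ ∀ ε : ℝ, 0 < ε → ε ≤ ε₀ → ∃ C : ℝ, 0 ≤ C ∧
          ∀ (S : ℕ)
            (F : Literature.MathematicalPhysics.QuantumFieldTheory.GaugeConfig 4 (2 * S + 1) G → ℝ),
            Measurable F → (∃ M : ℝ, ∀ U, |F U| ≤ M) →
              (∑ Λ : Finset (Literature.MathematicalPhysics.QuantumFieldTheory.Edge 4 (2 * S + 1)),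
                ε ^ (Fintype.card
                      (Literature.MathematicalPhysics.QuantumFieldTheory.Edge 4 (2 * S + 1)) - Λ.card) *
                  (1 - ε) ^ Λ.card *
                  ∫ U, ProbabilityTheory.condVar
                      (⨆ ℓ ∈ Λ, MeasurableSpace.comap
                        (fun V : Literature.MathematicalPhysics.QuantumFieldTheory.GaugeConfig 4
                          (2 * S + 1) G => V ℓ) inferInstance)
                      F (Literature.MathematicalPhysics.QuantumFieldTheory.wilsonMeasure (d := 4)
                        (L := 2 * S + 1) r.ρ β) U
                    ∂(Literature.MathematicalPhysics.QuantumFieldTheory.wilsonMeasure (d := 4)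
                      (L := 2 * S + 1) r.ρ β)) ≤
                C * ∑ ℓ : Literature.MathematicalPhysics.QuantumFieldTheory.Edge 4 (2 * S + 1),
                  ∫ U, ∫ g, (F U - F (Function.update U ℓ g)) ^ 2
                    ∂((Literature.MathematicalPhysics.QuantumFieldTheory.haarProbability G).tilted
                      (fun g' => -β * Literature.MathematicalPhysics.QuantumFieldTheory.wilsonAction
                        r.ρ (Function.update U ℓ g')))
                    ∂(Literature.MathematicalPhysics.QuantumFieldTheory.wilsonMeasure (d := 4)
                      (L := 2 * S + 1) r.ρ β) := by
  sorry

/-- **S4 · planted local-to-global for simply-connected simple `G`** (`stub_plantedLocalToGlobal`;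
HARDEST, load-bearing, OPEN — this is the crux's content in the line's form; the card's "share-localised
spectral independence along the planted revelation martingale").  For compact simple SIMPLY-CONNECTED `G`
(triage sharpening (α): `SU(N)`; centreless `G` are S5), faithful unitary `r`, `β ≥ 0`: IF the unpinned
measures are spectrally independent with constant 1 (S2's conclusion `EB`, the base case `η(ν₀) ≤ 1`)
AND `FS(G,r,β)` holds, THEN for every `ε₀ > 0` there are a free density `0 < ε ≤ ε₀` and `C ≥ 0` such
that for all `S` and all gauge-invariant bounded measurable `F`, `Var_μ F ≤ C · PCV_ε(F)` — pinning a
Bernoulli(1−ε) set of links at PLANTED values retains a volume-uniform fraction of the variance of every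
invariant observable (only arbitrarily small free densities are consumed by the composition, whose `ε₀`
comes from S3).  Intended proof (card, Lever (a)–(c), (α)–(β)): reveal the links of `U ∼ μ` one at a time
in uniformly random order; pathwise law of total variance `E[Var_{ν_i}φ | ν_{i−1}] =
(1 − η_φ(ν_{i−1})/#free)·Var_{ν_{i−1}}φ`; pins on FORESTS are pure gauge (the invariant sector sees only
pinned-cycle holonomies, density `O(θ⁴)` at pin density `θ`); a free link explains variance of an
invariant `φ` only when FRAMED, and then through the response of `φ` to the LOCAL invariant composite
"pinned cluster closed by `ℓ`", so in planted mean `Σ_{ℓ framed} Var(E[φ|U_ℓ,pins])` is a pinned-cluster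
expansion whose order-`k` term is `(Cθ)^k ×` finitely many FS susceptibilities `χ(O_K, O_K')` — FS as
typed is `∀ A B ∃ χ` with NO support dependence (triage (β)), so the proof must use FS for finitely many
shapes per order and bound the tail FS-free — closed by the ellipticity floor `η(ν) ≤ e^{cβ·|free cluster|}`
near the terminal density; the φ-INDEPENDENT path factor `Π_T = ∏(1 − η(ν_j)/(|E|−j))` gives the
submartingale identity `E[Var_{ν_T}φ/Π_T] ≥ Var_μ φ`, and the sup-over-pinnings constant (Chen–Eldan
Thm 24 / ALO verbatim) is FALSE here (adversarial pins = a gauge glass; a planted region that looks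
frustrated exists somewhere in every large torus), hence local constants `c_ℓ'(ν)` and local variance
shares tracked as a measure-valued supermartingale.  Why it might fail: a planted pin-DENSITY transition
(Cammarota–Biroli random pinning, arXiv:1106.5513, induces an ideal-glass transition iff extensive
configurational entropy; triage doubt 3) — the bet "FS ⇒ no transition in pin density" is Harris
numerology (`Δ > d/2 ⟺ ℓ¹` correlations ⟺ FS); kit j007328 (planted-pin SU(2) heat bath, `τ` vs `(θ, L)`)
is the cheapest falsifier and auto-attaches to the item.  Size XL / open.  Leans on: S2 (`EB`, hypothesis),
`wilsonMeasure_map_gaugeTransform_holds`, `IsGaugeInvariant`, `plaquetteHolonomy`, Mathlib `condVar`,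
`condExp`, martingale API (`MeasureTheory.Martingale`); literature (unproved, none vendored): Chen–Eldan
arXiv:2203.04163 Def. 20 / Prop. 21 / Claim 22 / Thm 24, Anari–Liu–Oveis Gharan arXiv:2001.00303,
Chen–Liu–Vigoda arXiv:2011.02075.  `stub_plantedLocalToGlobal_iff`: this is `∀ G, IsCompactSimpleLieGroup G →
SimplyConnectedSpace G → ∀ r β, 0 ≤ β → ElitzurBessel G r β → FiniteSusceptibility G r β → ∀ ε₀ > 0,
∃ ε ∈ (0,ε₀], ∃ C ≥ 0, PlantedLocalToGlobalAt G r β ε C`. -/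
theorem stub_plantedLocalToGlobal :
    ∀ (G : Type) [Group G] [TopologicalSpace G] [IsTopologicalGroup G] [CompactSpace G]
      [MeasurableSpace G] [BorelSpace G],
      Literature.MathematicalPhysics.QuantumFieldTheory.IsCompactSimpleLieGroup G →
      SimplyConnectedSpace G →
      ∀ (r : Literature.MathematicalPhysics.QuantumFieldTheory.LatticeRep G) (β : ℝ), 0 ≤ β →
        -- EB(G,r,β): spectral independence of the unpinned measures with constant 1 (= S2)
        (∀ S : ℕ, 1 ≤ S →
          ∀ φ : Literature.MathematicalPhysics.QuantumFieldTheory.GaugeConfig 4 (2 * S + 1) G → ℝ,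
            Measurable φ → (∃ M : ℝ, ∀ U, |φ U| ≤ M) →
              ∑ ℓ : Literature.MathematicalPhysics.QuantumFieldTheory.Edge 4 (2 * S + 1),
                ProbabilityTheory.variance
                  ((Literature.MathematicalPhysics.QuantumFieldTheory.wilsonMeasure (d := 4)
                      (L := 2 * S + 1) r.ρ β)[φ |
                    MeasurableSpace.comap
                      (fun V : Literature.MathematicalPhysics.QuantumFieldTheory.GaugeConfig 4
                        (2 * S + 1) G => V ℓ) inferInstance])
                  (Literature.MathematicalPhysics.QuantumFieldTheory.wilsonMeasure (d := 4)
                    (L := 2 * S + 1) r.ρ β) ≤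
                ProbabilityTheory.variance φ
                  (Literature.MathematicalPhysics.QuantumFieldTheory.wilsonMeasure (d := 4)
                    (L := 2 * S + 1) r.ρ β)) →
        -- FS(G,r,β): finite gauge-invariant susceptibility (the crux hypothesis, verbatim)
        (∀ A B : Literature.MathematicalPhysics.QuantumFieldTheory.YMSpecies G, ∃ χ : ℝ, ∀ S : ℕ,
          ∑ x ∈ Literature.Probability.LatticeModels.box 4 S,
            |ProbabilityTheory.covariance
                (fun U => A.F (Literature.MathematicalPhysics.QuantumLattice.torusLift (2 * S + 1) U))
                (fun U => B.F (Literature.MathematicalPhysics.QuantumLattice.configShift (-x)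
                  (Literature.MathematicalPhysics.QuantumLattice.torusLift (2 * S + 1) U)))
                (Literature.MathematicalPhysics.QuantumFieldTheory.wilsonMeasure (d := 4)
                  (L := 2 * S + 1) r.ρ β)| ≤ χ) →
        ∀ ε₀ : ℝ, 0 < ε₀ → ∃ ε : ℝ, 0 < ε ∧ ε ≤ ε₀ ∧ ∃ C : ℝ, 0 ≤ C ∧
          ∀ (S : ℕ)
            (F : Literature.MathematicalPhysics.QuantumFieldTheory.GaugeConfig 4 (2 * S + 1) G → ℝ),
            Measurable F → (∃ M : ℝ, ∀ U, |F U| ≤ M) →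
            Literature.MathematicalPhysics.QuantumFieldTheory.IsGaugeInvariant F →
              ProbabilityTheory.variance F
                  (Literature.MathematicalPhysics.QuantumFieldTheory.wilsonMeasure (d := 4)
                    (L := 2 * S + 1) r.ρ β) ≤
                C * ∑ Λ : Finset (Literature.MathematicalPhysics.QuantumFieldTheory.Edge 4 (2 * S + 1)),
                  ε ^ (Fintype.card
                        (Literature.MathematicalPhysics.QuantumFieldTheory.Edge 4 (2 * S + 1)) - Λ.card) *
                    (1 - ε) ^ Λ.card *
                    ∫ U, ProbabilityTheory.condVar
                        (⨆ ℓ ∈ Λ, MeasurableSpace.comap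
                          (fun V : Literature.MathematicalPhysics.QuantumFieldTheory.GaugeConfig 4
                            (2 * S + 1) G => V ℓ) inferInstance)
                        F (Literature.MathematicalPhysics.QuantumFieldTheory.wilsonMeasure (d := 4)
                          (L := 2 * S + 1) r.ρ β) U
                      ∂(Literature.MathematicalPhysics.QuantumFieldTheory.wilsonMeasure (d := 4)
                        (L := 2 * S + 1) r.ρ β) := by
  sorry

/-- **S5 · the centreless residual — NOT claimed by the line** (`stub_centrelessResidual`).
`IsCompactSimpleLieGroup G = IsSimpleCompactGroup G ∧ Nonempty (LatticeRep G)` admits centreless compact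
simple groups (`SO(3)`, `PSU(N)`, …: `π₁(G) ≠ 0`).  There the ideator's OBSTRUCTION note (item evidence
`OBSTRUCTION-centreless-groups.md`) and triage r1-1 (doubt 1) expect the CONCLUSION `UP` of the crux to
FAIL while `FS` holds ('t Hooft magnetic-twist sectors of the symmetric torus: `2^6` sectors of
asymptotically equal weight in a confined phase, separated by `ℤ_{|π₁|}`-monopole world-sheets of action
`≍ βS` — gauge-INVARIANT slow modes of the heat bath, de Forcrand–Jahn hep-lat/0205026), and the line's
mechanism is void (a framed free link can be the last link of a pinned 2-torus and carries the twist
label: the planted spectral-independence constant blows up at pin density `O(1)`).  This stub is the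
crux's implication `FS → UP_inv` restricted to `¬ SimplyConnectedSpace G`, isolated so that (i) the
positive stubs S1–S4 state only what the line believes TRUE, (ii) `¬ S5` is literally `¬ crux` on
centreless `G` (a cdisprove target; rigorously it needs equal sector weights = weak-coupling confinement
input), (iii) a tenure re-scoping of the crux to simply-connected `G` (recommended; `SU(N)` and the summit
`YangMills` are unaffected) makes it vacuous with S1–S4 untouched.  NO prover should staff it positively.
Size: open-problem either way.  Leans on: nothing beyond the crux vocabulary.
`stub_centrelessResidual_iff`: this is `∀ G, IsCompactSimpleLieGroup G → ¬ SimplyConnectedSpace G →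
∀ r β, 0 ≤ β → FiniteSusceptibility G r β → UniformPoincareInv G r β`. -/
theorem stub_centrelessResidual :
    ∀ (G : Type) [Group G] [TopologicalSpace G] [IsTopologicalGroup G] [CompactSpace G]
      [MeasurableSpace G] [BorelSpace G],
      Literature.MathematicalPhysics.QuantumFieldTheory.IsCompactSimpleLieGroup G →
      ¬ SimplyConnectedSpace G →
      ∀ (r : Literature.MathematicalPhysics.QuantumFieldTheory.LatticeRep G) (β : ℝ), 0 ≤ β →
        (∀ A B : Literature.MathematicalPhysics.QuantumFieldTheory.YMSpecies G, ∃ χ : ℝ, ∀ S : ℕ,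
          ∑ x ∈ Literature.Probability.LatticeModels.box 4 S,
            |ProbabilityTheory.covariance
                (fun U => A.F (Literature.MathematicalPhysics.QuantumLattice.torusLift (2 * S + 1) U))
                (fun U => B.F (Literature.MathematicalPhysics.QuantumLattice.configShift (-x)
                  (Literature.MathematicalPhysics.QuantumLattice.torusLift (2 * S + 1) U)))
                (Literature.MathematicalPhysics.QuantumFieldTheory.wilsonMeasure (d := 4)
                  (L := 2 * S + 1) r.ρ β)| ≤ χ) →
        ∃ C : ℝ, ∀ S : ℕ,
          ∀ F : Literature.MathematicalPhysics.QuantumFieldTheory.GaugeConfig 4 (2 * S + 1) G → ℝ,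
            Measurable F → (∃ M : ℝ, ∀ U, |F U| ≤ M) →
            Literature.MathematicalPhysics.QuantumFieldTheory.IsGaugeInvariant F →
              ProbabilityTheory.variance F
                  (Literature.MathematicalPhysics.QuantumFieldTheory.wilsonMeasure (d := 4)
                    (L := 2 * S + 1) r.ρ β) ≤
                C * ∑ ℓ : Literature.MathematicalPhysics.QuantumFieldTheory.Edge 4 (2 * S + 1),
                  ∫ U, ∫ g, (F U - F (Function.update U ℓ g)) ^ 2
                    ∂((Literature.MathematicalPhysics.QuantumFieldTheory.haarProbability G).tilted
                      (fun g' => -β * Literature.MathematicalPhysics.QuantumFieldTheory.wilsonAction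
                        r.ρ (Function.update U ℓ g')))
                    ∂(Literature.MathematicalPhysics.QuantumFieldTheory.wilsonMeasure (d := 4)
                      (L := 2 * S + 1) r.ρ β) := by
  sorry

/-! ## `Iff.rfl` bridges: each stub is the readable statement it claims to be -/

theorem stub_orbitSlice_iff :
    type_of% stub_orbitSlice ↔
      ∀ (G : Type) [Group G] [TopologicalSpace G] [IsTopologicalGroup G] [CompactSpace G]
        [MeasurableSpace G] [BorelSpace G], ∀ (r : LatticeRep G) (β : ℝ), 0 ≤ β →
        UniformPoincareInv G r β → UniformPoincare G r β :=
  Iff.rfl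

theorem stub_elitzurBessel_iff :
    type_of% stub_elitzurBessel ↔
      ∀ (G : Type) [Group G] [TopologicalSpace G] [IsTopologicalGroup G] [CompactSpace G]
        [MeasurableSpace G] [BorelSpace G], ∀ (r : LatticeRep G) (β : ℝ), ElitzurBessel G r β := by
  constructor
  · intro h G _ _ _ _ _ _ r β S hS φ hφ hb
    exact h G r β S hS φ hφ hb
  · intro h G _ _ _ _ _ _ r β S hS φ hφ hb
    exact h G r β S hS φ hφ hb

theorem stub_plantedTerminal_iff :
    type_of% stub_plantedTerminal ↔
      ∀ (G : Type) [Group G] [TopologicalSpace G] [IsTopologicalGroup G] [CompactSpace G]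
        [MeasurableSpace G] [BorelSpace G], ∀ (r : LatticeRep G) (β : ℝ), 0 ≤ β →
        ∃ ε₀ : ℝ, 0 < ε₀ ∧ ε₀ < 1 ∧ ∀ ε : ℝ, 0 < ε → ε ≤ ε₀ → ∃ C : ℝ, 0 ≤ C ∧
          PlantedTerminalAt G r β ε C :=
  Iff.rfl

theorem stub_plantedLocalToGlobal_iff :
    type_of% stub_plantedLocalToGlobal ↔
      ∀ (G : Type) [Group G] [TopologicalSpace G] [IsTopologicalGroup G] [CompactSpace G]
        [MeasurableSpace G] [BorelSpace G], IsCompactSimpleLieGroup G → SimplyConnectedSpace G →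
        ∀ (r : LatticeRep G) (β : ℝ), 0 ≤ β → ElitzurBessel G r β → FiniteSusceptibility G r β →
        ∀ ε₀ : ℝ, 0 < ε₀ → ∃ ε : ℝ, 0 < ε ∧ ε ≤ ε₀ ∧ ∃ C : ℝ, 0 ≤ C ∧
          PlantedLocalToGlobalAt G r β ε C :=
  Iff.rfl

theorem stub_centrelessResidual_iff :
    type_of% stub_centrelessResidual ↔
      ∀ (G : Type) [Group G] [TopologicalSpace G] [IsTopologicalGroup G] [CompactSpace G]
        [MeasurableSpace G] [BorelSpace G], IsCompactSimpleLieGroup G → ¬ SimplyConnectedSpace G →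
        ∀ (r : LatticeRep G) (β : ℝ), 0 ≤ β → FiniteSusceptibility G r β → UniformPoincareInv G r β :=
  Iff.rfl

/-! ## Composition (closed glue on the named predicates, then the crux BY NAME from the stubs) -/

section Glue

variable {G : Type} [Group G] [TopologicalSpace G] [IsTopologicalGroup G] [CompactSpace G]
  [MeasurableSpace G] [BorelSpace G]

/-- Middle + terminal stage at one free density give `UP_inv` with constant `C_M · C_T`. -/
theorem uniformPoincareInv_of_planted (r : LatticeRep G) (β ε CM CT : ℝ) (hCM : 0 ≤ CM)
    (hM : PlantedLocalToGlobalAt G r β ε CM) (hT : PlantedTerminalAt G r β ε CT) :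
    UniformPoincareInv G r β := by
  refine ⟨CM * CT, fun S F hF hB hI => le_trans (hM S F hF hB hI) ?_⟩
  rw [mul_assoc]
  exact mul_le_mul_of_nonneg_left (hT S F hF hB) hCM

/-- The simply-connected case of the crux from S2, S3, S4 (as hypotheses) and S1. -/
theorem uniformPoincare_of_stubs (h1 : type_of% stub_orbitSlice) (h2 : type_of% stub_elitzurBessel)
    (h3 : type_of% stub_plantedTerminal) (h4 : type_of% stub_plantedLocalToGlobal)
    (hG : IsCompactSimpleLieGroup G) (hsc : SimplyConnectedSpace G) (r : LatticeRep G) (β : ℝ)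
    (hβ : 0 ≤ β) (hFS : FiniteSusceptibility G r β) : UniformPoincare G r β := by
  refine h1 G r β hβ ?_
  obtain ⟨ε₀, hε₀, -, hT⟩ := h3 G r β hβ
  obtain ⟨ε, hε, hεε₀, CM, hCM, hM⟩ := h4 G hG hsc r β hβ (h2 G r β) hFS ε₀ hε₀
  obtain ⟨CT, -, hCT⟩ := hT ε hε hεε₀
  exact uniformPoincareInv_of_planted r β ε CM CT hCM hM hCT

end Glue

/-- **The line concludes the crux.** `SusceptibilityToPoincare` BY NAME from the five registered stubs:
orbit-slice reduction (S1) to invariant `F`; for simply-connected `G` the planted chain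
`Var ≤ C_M · PCV_ε ≤ C_M C_T · ℰ_hb` (S4 fed with S2 and FS, at a free density `ε ≤ ε₀(β)` from S3);
for centreless `G` the unclaimed residual S5. -/
theorem SusceptibilityToPoincare_of : SusceptibilityToPoincare := by
  intro G _ _ _ _ _ _ hG r β hβ hFS
  by_cases hsc : SimplyConnectedSpace G
  · exact uniformPoincare_of_stubs stub_orbitSlice stub_elitzurBessel stub_plantedTerminal
      stub_plantedLocalToGlobal hG hsc r β hβ hFS
  · exact stub_orbitSlice G r β hβ (stub_centrelessResidual G hG hsc r β hβ hFS)

end Summit.QuantumFields.YangMills.Cruxes.SusceptibilityToPoincare.PlantedLinkPinning
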